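import Summits.CriticalPhenomena.PercolationContinuityZ3.Theorems.Transplant.LineGraphSiteContinuity
import Summits.CriticalPhenomena.PercolationContinuityZ3.Theorems.Transplant.AutEndStateFCCayley
import Summits.CriticalPhenomena.PercolationContinuityZ3.Theorems.Transplant.AutEndStateFCAction
import HarnessLib

/-!
# Conjecture 4 in SITE form on the LINE GRAPHS of the FC-split end-state customers: `p_c^{site} < 1` and `θ^{site}(p_c^{site}) = 0` at every vertex of
# `L(Cay(Γ; S))` for every `Γ` with a finite-index subgroup carrying two independent characters and a central survivor (e.g. `Γ` virtually `K × ℤ^d`,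
# `d ≥ 2`), and of `L(X)` for every cocompact finite-stabiliser action with such a datum

builds on p205010 (kernel theorem, internal audit signed; external expert review pending).  Lane `prim-bschramm`, seat `prim-bschramm-gen-1` gen 7 (GEN pen,
p3 lineage).  Helper file (`--supports stmt-CriticalPhenomena-4575 --as helper`); def-free; unconditional; catalogue rows only.  Fisher–Essam / Kesten transport
(p2 gen 13's device «LineGraphPercolation» / «LineGraphSiteContinuity»: `siteCriticalProb_lineGraph_eq`, `lineGraph_siteCriticalContinuity_at` — cited, not
restated; gen-5 g3's «LineGraphSiteC2Customers» is the same transport for the virtually nilpotent rows) of this seat's bond rows «AutEndStateFCCayley»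
(`EndStateCayley.conj4_cayley_of_vb1_central`, `conj4_cayley_of_virtually_prod_zd`) and «AutEndStateFCAction» (`AutCyl.conj4_fc_of_finiteStabilizers`), which
carry `p_c < 1` in their conclusion — so the site rows are hypothesis-free.  NOTHING is claimed about the `@[conjecture]` `BenjaminiSchramm1996_conj4_endState`,
nor about site percolation on the graphs themselves (only on their line graphs).
[cite: BenjaminiSchramm1996, Conj. 4; §2 (Cayley graphs; almost transitive graphs)] [cite: Kesten1982, §3.1 Prop. 3.1] [cite: MartineauSevero2019, Cor. 2.2]
-/

noncomputable section

namespace Summit.CriticalPhenomena.PercolationContinuityZ3.Theorems.Transplant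

open SimpleGraph Literature.Barriers.CriticalPhenomena Literature.Probability.LatticeModels Literature.Probability.Percolation
open scoped Classical

/-! ## §1 Line graphs of Cayley graphs with the virtual central datum -/

namespace EndStateCayley

variable {Γ : Type} [Group Γ]

/-- **Conjectures 1 + 4 (SITE form) on the line graph of every Cayley graph of every group with a finite-index `Γ₀` carrying two independent characters and a
`Γ₀`-central element they do not kill**: `p_c^{site}(L, e) < 1` and `θ^{site}_e(p_c^{site}) = 0` at every vertex `e` of `L(Cay(Γ; S))` (every finite generating
`S`) — `conj4_cayley_of_vb1_central` at an end-vertex of `e`, transported by Fisher–Essam.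
builds on p205010 (kernel theorem, internal audit signed; external expert review pending).
[cite: BenjaminiSchramm1996, §2 Conj. 1, Conj. 4 (Cayley graphs)] [cite: Kesten1982, §3.1 Prop. 3.1] -/
theorem lineGraph_site_conj4_cayley_of_vb1_central (S : Finset Γ) (hS : Subgroup.closure (S : Set Γ) = ⊤) (Γ₀ : Subgroup Γ) [Γ₀.FiniteIndex]
    (ψ₀ ψ₁ : Γ₀ →* Multiplicative ℤ) (a b : Γ₀)
    (hind : Multiplicative.toAdd (ψ₀ a) * Multiplicative.toAdd (ψ₁ b) ≠ Multiplicative.toAdd (ψ₁ a) * Multiplicative.toAdd (ψ₀ b))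
    (z : Γ₀) (hz : ∀ h : Γ₀, h * z = z * h) (hψz : ψ₀ z ≠ 1 ∨ ψ₁ z ≠ 1) (e : (mulCayley (↑S : Set Γ)).edgeSet) :
    siteCriticalProb (mulCayley (↑S : Set Γ)).lineGraph e < 1 ∧
      siteTheta (mulCayley (↑S : Set Γ)).lineGraph e (siteCriticalProbIOf (mulCayley (↑S : Set Γ)).lineGraph e) = 0 := by
  have hg : (e : Sym2 Γ).out.1 ∈ (e : Sym2 Γ) := Sym2.out_fst_mem _
  haveI : Countable Γ :=
    countable_of_connected_of_locallyFinite (mulCayley (↑S : Set Γ)) (CayleyScaled.connected_mulCayley_of_closure S hS) (e : Sym2 Γ).out.1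
  obtain ⟨hpc, hθ⟩ := conj4_cayley_of_vb1_central S hS Γ₀ ψ₀ ψ₁ a b hind z hz hψz (e : Sym2 Γ).out.1
  have he : siteCriticalProb (mulCayley (↑S : Set Γ)).lineGraph e < 1 := by rwa [siteCriticalProb_lineGraph_eq e hg]
  exact ⟨he, lineGraph_siteCriticalContinuity_at e hg hθ⟩

/-- **… in particular on `L(Cay(Γ; S))` for every group `Γ` VIRTUALLY `K × ℤ^d`, `d ≥ 2`, `K` ANY group** (an injective `K × ℤ^d → Γ` with finite-index image),
every finite generating `S`. builds on p205010 (kernel theorem, internal audit signed; external expert review pending).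
[cite: BenjaminiSchramm1996, §2 Conj. 1, Conj. 4 (Cayley graphs)] [cite: Kesten1982, §3.1 Prop. 3.1] -/
theorem lineGraph_site_conj4_cayley_of_virtually_prod_zd {K : Type} [Group K] {d : ℕ} (hd : 2 ≤ d) (ι : K × Multiplicative (Fin d → ℤ) →* Γ)
    (hι : Function.Injective ι) [ι.range.FiniteIndex] (S : Finset Γ) (hS : Subgroup.closure (S : Set Γ) = ⊤) (e : (mulCayley (↑S : Set Γ)).edgeSet) :
    siteCriticalProb (mulCayley (↑S : Set Γ)).lineGraph e < 1 ∧
      siteTheta (mulCayley (↑S : Set Γ)).lineGraph e (siteCriticalProbIOf (mulCayley (↑S : Set Γ)).lineGraph e) = 0 := by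
  have hg : (e : Sym2 Γ).out.1 ∈ (e : Sym2 Γ) := Sym2.out_fst_mem _
  haveI : Countable Γ :=
    countable_of_connected_of_locallyFinite (mulCayley (↑S : Set Γ)) (CayleyScaled.connected_mulCayley_of_closure S hS) (e : Sym2 Γ).out.1
  obtain ⟨hpc, hθ⟩ := conj4_cayley_of_virtually_prod_zd hd ι hι S hS (e : Sym2 Γ).out.1
  have he : siteCriticalProb (mulCayley (↑S : Set Γ)).lineGraph e < 1 := by rwa [siteCriticalProb_lineGraph_eq e hg]
  exact ⟨he, lineGraph_siteCriticalContinuity_at e hg hθ⟩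

end EndStateCayley

/-! ## §2 Line graphs of graphs with a cocompact finite-stabiliser FC action -/

namespace AutCyl

variable {W : Type} {X : SimpleGraph W} [X.LocallyFinite] {A : Type} [Group A] [MulAction A W]

/-- **Conjectures 1 + 4 (SITE form) on the line graph of every connected locally finite graph carrying an action by automorphisms with finitely many orbits and
finite stabilisers of a group with two independent characters and an FC witness** (`z` of non-trivial character commuting with a finite-index `N`):
`p_c^{site}(L(X), e) < 1` and `θ^{site}_e(p_c^{site}) = 0` at every vertex `e` of `L(X)` — `conj4_fc_of_finiteStabilizers` at an end-vertex, transported.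
builds on p205010 (kernel theorem, internal audit signed; external expert review pending).
[cite: BenjaminiSchramm1996, §2 Conj. 1, Conj. 4 (almost transitive graphs)] [cite: Kesten1982, §3.1 Prop. 3.1] -/
theorem lineGraph_site_conj4_fc_of_finiteStabilizers (hc : X.Connected) (hact : IsActionByAut X A) (reps : Finset W)
    (hcover : ∀ w : W, ∃ a : A, ∃ r ∈ reps, a • r = w) (hfin : ∀ r ∈ reps, (MulAction.stabilizer A r : Set A).Finite)
    (ψ₀ ψ₁ : A →* Multiplicative ℤ) (a b : A)
    (hind : Multiplicative.toAdd (ψ₀ a) * Multiplicative.toAdd (ψ₁ b) ≠ Multiplicative.toAdd (ψ₁ a) * Multiplicative.toAdd (ψ₀ b))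
    (z : A) (hψz : ψ₀ z ≠ 1 ∨ ψ₁ z ≠ 1) (N : Subgroup A) [N.FiniteIndex] (hNz : ∀ n ∈ N, n * z = z * n) (e : X.edgeSet) :
    siteCriticalProb X.lineGraph e < 1 ∧ siteTheta X.lineGraph e (siteCriticalProbIOf X.lineGraph e) = 0 := by
  have hx : (e : Sym2 W).out.1 ∈ (e : Sym2 W) := Sym2.out_fst_mem _
  haveI : Countable W := countable_of_connected_of_locallyFinite X hc (e : Sym2 W).out.1
  obtain ⟨hpc, hθ⟩ := conj4_fc_of_finiteStabilizers hc hact reps hcover hfin ψ₀ ψ₁ a b hind z hψz N hNz (e : Sym2 W).out.1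
  have he : siteCriticalProb X.lineGraph e < 1 := by rwa [siteCriticalProb_lineGraph_eq e hx]
  exact ⟨he, lineGraph_siteCriticalContinuity_at e hx hθ⟩

/-- **… in particular for every cocompact finite-stabiliser action of `K × ℤ^d`, `d ≥ 2`, `K` ANY group.**
builds on p205010 (kernel theorem, internal audit signed; external expert review pending).
[cite: BenjaminiSchramm1996, §2 Conj. 1, Conj. 4 (almost transitive graphs)] [cite: Kesten1982, §3.1 Prop. 3.1] -/
theorem lineGraph_site_conj4_prod_zd_of_finiteStabilizers {K : Type} [Group K] {d : ℕ} (hd : 2 ≤ d) [MulAction (K × Multiplicative (Fin d → ℤ)) W]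
    (hc : X.Connected) (hact : IsActionByAut X (K × Multiplicative (Fin d → ℤ))) (reps : Finset W)
    (hcover : ∀ w : W, ∃ a : K × Multiplicative (Fin d → ℤ), ∃ r ∈ reps, a • r = w)
    (hfin : ∀ r ∈ reps, (MulAction.stabilizer (K × Multiplicative (Fin d → ℤ)) r : Set (K × Multiplicative (Fin d → ℤ))).Finite) (e : X.edgeSet) :
    siteCriticalProb X.lineGraph e < 1 ∧ siteTheta X.lineGraph e (siteCriticalProbIOf X.lineGraph e) = 0 := by
  have hx : (e : Sym2 W).out.1 ∈ (e : Sym2 W) := Sym2.out_fst_mem _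
  haveI : Countable W := countable_of_connected_of_locallyFinite X hc (e : Sym2 W).out.1
  obtain ⟨hpc, hθ⟩ := conj4_prod_zd_of_finiteStabilizers hd hc hact reps hcover hfin (e : Sym2 W).out.1
  have he : siteCriticalProb X.lineGraph e < 1 := by rwa [siteCriticalProb_lineGraph_eq e hx]
  exact ⟨he, lineGraph_siteCriticalContinuity_at e hx hθ⟩

end AutCyl

end Summit.CriticalPhenomena.PercolationContinuityZ3.Theorems.Transplant

end
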